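import Literature.Topology.FourManifolds.HCobordismAlignedChartsSpheres
import Mathlib.GroupTheory.Perm.Fin
import HarnessLib

/-!
# Milnor 1965, proof of Thm. 5.4, Assertion 6, (a)–(b) at the upper critical point: the
# reflection `x ↦ e₀ - x` turns the chart `g₂` at `p'` for `(f, ξ)` into a chart of the lower
# type for `(a - f, -ξ)` — so that the trajectories into `p'` are read off from those from `p`

Topic `Literature/Topology/FourManifolds` (fact seat
`provefact-Literature.Topology.FourManifolds.Cobord-05c749f4e5`; groundwork for the named fact
`Literature.Topology.FourManifolds.Cobordism.Milnor1965_cancellation_alignedCharts` of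
`HCobordismModelChart.lean`).  Milnor turns triads about throughout (*"Replacing `f` by `-f`
one deduces a similar proposition"*, Lemma 4.7, PDF p. 25; *"the triad is 'turned about'"*,
proof of Thm. 9.1), and in the model of Preliminary Hypothesis 5.5 the two critical points
`0` (index `λ`) and `e` (index `λ + 1`) of `η⃗` are exchanged by `x ↦ e - x` composed with a
reversal of the coordinates `x₁, …, x_{m-1}`, `η⃗` going to `-η⃗` of the complementary index
and `F` to `const - F`.  This file proves that bookkeeping and deduces, for an `E`-valued chart
`Ψ'` about `p'` carrying `ξ` to `η⃗` with target a ball about `e₀` (the format of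
`Literature.Topology.FourManifolds.IsGradientLike.exists_upperChart_target_eq_ball`), the duals
of the results of `HCobordismAlignedChartsRays.lean` and `HCobordismAlignedChartsSpheres.lean`:

* `Literature.Topology.FourManifolds.exists_forall_apply_sub_single_eq_exp_smul_of_tendsto_atTop`
  — a trajectory going to `p' = Ψ'⁻¹(e₀)` is eventually a radial ray of the stable plane
  `x_{k+1} = ⋯ = 0` through `e₀`: `Ψ'(γ t) - e₀ = e^{-(t - t₀)} (Ψ'(γ t₀) - e₀)` for
  `t ≥ t₀`;
* `Literature.Topology.FourManifolds.leftHandSphere_eq_symm_image_of_ball` — for `ξ(f) ≥ 0`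
  and `f` carried to `F` (based at `f p`), the left-hand sphere of `p'` in the level
  `f(p') - t²`, `0 < t < r/4`, is `Ψ'⁻¹{x ∈ B(e₀, r) | x_{k+1} = ⋯ = 0, F(x) = f(p') - t²}`
  (Milnor's `S_L = φ_L(S^{λ} × 0)`, Def. 3.9, for the coordinates of PH 5.5 at `e`).

## References

* J. Milnor, *Lectures on the h-cobordism theorem*, notes by L. Siebenmann and J. Sondow,
  Princeton Mathematical Notes (1965): Def. 3.9 (PDF p. 16), proof of Thm. 3.12 (PDF p. 18),
  Lemma 4.7, remark (PDF p. 25), Preliminary Hypothesis 5.5 (PDF p. 27), proof of Thm. 5.4,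
  Assertion 6, (a), (b) (PDF p. 30). [MilnorHCobordism1965]
-/

open scoped Manifold ContDiff Topology
open Set Function Filter

noncomputable section

namespace Literature.Topology.FourManifolds

/-! ### The coordinate reversal `j ↦ m - j` (`0 ↦ 0`) and the reflected model -/

section Model

variable {m : ℕ} [NeZero m]

/-- The values of the permutation `π = finRotate ∘ rev` of `Fin m`: `π 0 = 0` and `π j = m - j`
for `j ≠ 0` (the reversal of the coordinates `1, …, m - 1`). [folklore] -/
theorem val_revPerm_trans_finRotate (j : Fin m) :
    ((Fin.revPerm.trans (finRotate m) j : Fin m) : ℕ) = if (j : ℕ) = 0 then 0 else m - j := by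
  obtain ⟨n, hn⟩ := Nat.exists_eq_succ_of_ne_zero (NeZero.ne m)
  subst hn
  rw [Equiv.trans_apply, Fin.revPerm_apply, finRotate_apply, Fin.val_add_one]
  by_cases hj : (j : ℕ) = 0
  · have hj' : j = 0 := Fin.ext hj
    subst hj'
    simp [Fin.rev_zero]
  · have hne : Fin.rev j ≠ Fin.last n := by
      intro h
      have := congrArg Fin.val h
      rw [Fin.val_rev, Fin.val_last] at this
      omega
    rw [if_neg hne, if_neg hj, Fin.val_rev]
    omega

/-- `π` fixes `0`. [folklore] -/
theorem revPerm_trans_finRotate_zero : (Fin.revPerm.trans (finRotate m) (0 : Fin m) : Fin m) = 0 :=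
  Fin.ext (by rw [val_revPerm_trans_finRotate]; simp)

/-- `π` is an involution. [folklore] -/
theorem revPerm_trans_finRotate_apply_apply (j : Fin m) :
    Fin.revPerm.trans (finRotate m) (Fin.revPerm.trans (finRotate m) j) = j := by
  apply Fin.ext
  rw [val_revPerm_trans_finRotate, val_revPerm_trans_finRotate]
  have hj := j.2
  by_cases h0 : (j : ℕ) = 0
  · simp [h0]
  · rw [if_neg h0]
    have : ¬ (m - (j : ℕ) = 0) := by omega
    rw [if_neg this]
    omega

/-- **The reflected model field**: with `z = A_π(e₀ - x)` (`z_j = (e₀ - x)_{π j}`), the field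
`η⃗ = milnorCancellationField k v` at `x` read through `A_π` is `milnorCancellationField
(m - 1 - k) v` at `z`, when `v(x₀) = 1 - x₀` (zone at `e₀`) and `v(1 - x₀) = 1 - x₀` (zone at
`0`): the contracting directions `x₀ - 1, x₁, …, x_k` at `e₀` become expanding for the
reflected field `A_π ∘ (-1) ∘ η⃗ ∘ (e₀ - A_π⁻¹ ·)` … precisely, `A_π (η⃗ x) = η⃗'(z)` where
the chart `x ↦ A_π(e₀ - x)` carries `-η⃗` to `η⃗'`. [cite: MilnorHCobordism1965, Preliminary Hypothesis 5.5 (PDF p. 27); Lemma 4.7, remark (PDF p. 25)] -/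
theorem piLpCongrLeft_milnorCancellationField_eq_reflect {k : ℕ} (hk : k < m) (v : ℝ → ℝ)
    {x : EuclideanSpace ℝ (Fin m)} (hv1 : v (x 0) = 1 - x 0) (hv0 : v (1 - x 0) = 1 - x 0) :
    LinearIsometryEquiv.piLpCongrLeft 2 ℝ ℝ (Fin.revPerm.trans (finRotate m)).symm
        (milnorCancellationField k v x) =
      milnorCancellationField (m - 1 - k) v
        (LinearIsometryEquiv.piLpCongrLeft 2 ℝ ℝ (Fin.revPerm.trans (finRotate m)).symm
          (EuclideanSpace.single (0 : Fin m) (1 : ℝ) - x)) := by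
  set π : Equiv.Perm (Fin m) := Fin.revPerm.trans (finRotate m) with hπ
  ext j
  simp only [piLpCongrLeft_symm_apply, milnorCancellationField_apply, PiLp.sub_apply,
    PiLp.single_apply]
  have hπj := val_revPerm_trans_finRotate j
  have hjm := j.2
  by_cases hj0 : (j : ℕ) = 0
  · -- `j = 0`, `π j = 0`
    have hj0' : j = 0 := Fin.ext (by rw [hj0, Fin.val_zero])
    subst hj0'
    have hπ0' : (π 0 : Fin m) = 0 := revPerm_trans_finRotate_zero
    rw [hπ0']
    simp [hv1, hv0]
  · have hπv : ((π j : Fin m) : ℕ) = m - j := by rw [hπ, hπj, if_neg hj0]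
    have hπne : ((π j : Fin m) : ℕ) ≠ 0 := by rw [hπv]; omega
    have hπne' : (π j : Fin m) ≠ 0 := fun h => hπne (by rw [h, Fin.val_zero])
    by_cases hjk : (j : ℕ) ≤ m - 1 - k
    · -- contracting for the reflected field: `π j > k`
      have hgt : ¬ ((π j : Fin m) : ℕ) ≤ k := by rw [hπv]; omega
      simp only [hπne, ↓reduceIte, hgt, hj0, hjk, hπne']
      ring
    · -- expanding for the reflected field: `1 ≤ π j ≤ k`
      have hle : ((π j : Fin m) : ℕ) ≤ k := by rw [hπv]; omega
      simp only [hπne, ↓reduceIte, hle, hj0, hjk, hπne']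
      ring

/-- **The reflected `F`**: with `z = A_π(e₀ - x)` as above, inside both zones,
`milnorCancellationMorse (m - 1 - k) v (a - F(e₀)) z = a - F(x)` for `F = milnorCancellationMorse
k v c₀` (`F(e₀) = c₀ + 2∫₀¹ v`): the reflection carries `a - F` to the `F` of the reflected
model. [cite: MilnorHCobordism1965, proof of Thm. 5.4, Assertion 6 (PDF p. 30); Lemma 4.7, remark (PDF p. 25)] -/
theorem milnorCancellationMorse_reflect {k : ℕ} (hk : k < m) (v : ℝ → ℝ) (c₀ a : ℝ)
    {x : EuclideanSpace ℝ (Fin m)}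
    (hx1 : 2 * ∫ t in (0 : ℝ)..(x 0), v t = 2 * (∫ t in (0 : ℝ)..1, v t) - (x 0 - 1) ^ 2)
    (hx0 : 2 * ∫ t in (0 : ℝ)..(1 - x 0), v t = (1 - x 0) ^ 2) :
    milnorCancellationMorse (m - 1 - k) v (a - (c₀ + 2 * ∫ t in (0 : ℝ)..1, v t))
        (LinearIsometryEquiv.piLpCongrLeft 2 ℝ ℝ (Fin.revPerm.trans (finRotate m)).symm
          (EuclideanSpace.single (0 : Fin m) (1 : ℝ) - x)) =
      a - milnorCancellationMorse k v c₀ x := by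
  set π : Equiv.Perm (Fin m) := Fin.revPerm.trans (finRotate m) with hπ
  set z : EuclideanSpace ℝ (Fin m) :=
    LinearIsometryEquiv.piLpCongrLeft 2 ℝ ℝ π.symm (EuclideanSpace.single (0 : Fin m) (1 : ℝ) - x)
    with hz
  have hzj : ∀ j : Fin m, z j = (EuclideanSpace.single (0 : Fin m) (1 : ℝ) - x) (π j) := fun j =>
    piLpCongrLeft_symm_apply _ _ _
  have hz0 : z 0 = 1 - x 0 := by
    rw [hzj, show (π 0 : Fin m) = 0 from revPerm_trans_finRotate_zero]
    simp
  -- `z_j = -x_{π j}` for `j ≠ 0`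
  have hzsq : ∀ j : Fin m, (j : ℕ) ≠ 0 → (z j) ^ 2 = (x (π j)) ^ 2 := by
    intro j hj0
    have hπv : ((π j : Fin m) : ℕ) = m - j := by rw [hπ, val_revPerm_trans_finRotate, if_neg hj0]
    have hπne' : (π j : Fin m) ≠ 0 := fun h => by
      have h1 := congrArg Fin.val h
      rw [hπv, Fin.val_zero] at h1
      have := j.2
      omega
    rw [hzj]
    simp [hπne']
  -- the two sums, re-indexed through `π`
  have hS1 : ∑ j ∈ Finset.univ.filter (fun j : Fin m => (j : ℕ) ≠ 0 ∧ (j : ℕ) ≤ m - 1 - k),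
      (z j) ^ 2 = ∑ i ∈ Finset.univ.filter (fun i : Fin m => k < (i : ℕ)), (x i) ^ 2 := by
    rw [Finset.sum_filter, Finset.sum_filter,
      ← Equiv.sum_comp π (fun i => if k < (i : ℕ) then (x i) ^ 2 else 0)]
    refine Finset.sum_congr rfl fun j _ => ?_
    have hπj := val_revPerm_trans_finRotate j
    have hjm := j.2
    by_cases hj0 : (j : ℕ) = 0
    · have hπ0 : ((π j : Fin m) : ℕ) = 0 := by rw [hπ, hπj, if_pos hj0]
      simp [hj0, hπ0]
    · have hπv : ((π j : Fin m) : ℕ) = m - j := by rw [hπ, hπj, if_neg hj0]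
      by_cases hjk : (j : ℕ) ≤ m - 1 - k
      · have h1 : k < ((π j : Fin m) : ℕ) := by rw [hπv]; omega
        rw [if_pos ⟨hj0, hjk⟩, if_pos h1, hzsq j hj0]
      · have h1 : ¬ k < ((π j : Fin m) : ℕ) := by rw [hπv]; omega
        rw [if_neg (fun h => hjk h.2), if_neg h1]
  have hS2 : ∑ j ∈ Finset.univ.filter (fun j : Fin m => m - 1 - k < (j : ℕ)), (z j) ^ 2 =
      ∑ i ∈ Finset.univ.filter (fun i : Fin m => (i : ℕ) ≠ 0 ∧ (i : ℕ) ≤ k), (x i) ^ 2 := by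
    rw [Finset.sum_filter, Finset.sum_filter,
      ← Equiv.sum_comp π (fun i => if (i : ℕ) ≠ 0 ∧ (i : ℕ) ≤ k then (x i) ^ 2 else 0)]
    refine Finset.sum_congr rfl fun j _ => ?_
    have hπj := val_revPerm_trans_finRotate j
    have hjm := j.2
    by_cases hj0 : (j : ℕ) = 0
    · have hπ0 : ((π j : Fin m) : ℕ) = 0 := by rw [hπ, hπj, if_pos hj0]
      have h1 : ¬ (m - 1 - k < (j : ℕ)) := by rw [hj0]; omega
      simp [hπ0, h1]
    · have hπv : ((π j : Fin m) : ℕ) = m - j := by rw [hπ, hπj, if_neg hj0]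
      by_cases hjk : m - 1 - k < (j : ℕ)
      · have h1 : ((π j : Fin m) : ℕ) ≠ 0 ∧ ((π j : Fin m) : ℕ) ≤ k := by
          rw [hπv]; constructor <;> omega
        rw [if_pos hjk, if_pos h1, hzsq j hj0]
      · have h1 : ¬ (((π j : Fin m) : ℕ) ≠ 0 ∧ ((π j : Fin m) : ℕ) ≤ k) := by
          rw [hπv]; omega
        rw [if_neg hjk, if_neg h1]
  rw [milnorCancellationMorse, milnorCancellationMorse, hz0, hx0, hx1, hS1, hS2]
  ring

/-- The stable plane of `e₀` (`x_{k+1} = ⋯ = 0`) corresponds to the unstable plane of `0` of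
the reflected model (`z₁ = ⋯ = z_{m-1-k} = 0`). [cite: MilnorHCobordism1965, Preliminary Hypothesis 5.5 (PDF p. 27)] -/
theorem forall_reflect_apply_eq_zero_iff {k : ℕ} (hk : k < m) (x : EuclideanSpace ℝ (Fin m)) :
    (∀ j : Fin m, (j : ℕ) ≠ 0 → (j : ℕ) ≤ m - 1 - k →
      LinearIsometryEquiv.piLpCongrLeft 2 ℝ ℝ (Fin.revPerm.trans (finRotate m)).symm
        (EuclideanSpace.single (0 : Fin m) (1 : ℝ) - x) j = 0) ↔
    ∀ i : Fin m, k < (i : ℕ) → x i = 0 := by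
  set π : Equiv.Perm (Fin m) := Fin.revPerm.trans (finRotate m) with hπ
  have hval : ∀ j : Fin m, (j : ℕ) ≠ 0 → ((π j : Fin m) : ℕ) = m - j := fun j hj0 => by
    rw [hπ, val_revPerm_trans_finRotate, if_neg hj0]
  have hcoord : ∀ j : Fin m, (j : ℕ) ≠ 0 →
      LinearIsometryEquiv.piLpCongrLeft 2 ℝ ℝ π.symm (EuclideanSpace.single (0 : Fin m) (1 : ℝ) - x) j =
        -x (π j) := by
    intro j hj0
    have hπne' : (π j : Fin m) ≠ 0 := fun h => by
      have h1 := congrArg Fin.val h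
      rw [hval j hj0, Fin.val_zero] at h1
      have := j.2
      omega
    rw [piLpCongrLeft_symm_apply]
    simp [hπne']
  constructor
  · intro h i hik
    have him := i.2
    have hi0 : (i : ℕ) ≠ 0 := by omega
    -- `i = π j` with `j = π i`
    set j : Fin m := π i with hj
    have hjv : (j : ℕ) = m - i := hval i hi0
    have hj0 : (j : ℕ) ≠ 0 := by rw [hjv]; omega
    have hjk : (j : ℕ) ≤ m - 1 - k := by rw [hjv]; omega
    have h1 := h j hj0 hjk
    rw [hcoord j hj0, hj, revPerm_trans_finRotate_apply_apply] at h1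
    linarith
  · intro h j hj0 hjk
    rw [hcoord j hj0, h (π j) (by rw [hval j hj0]; omega), neg_zero]

/-- The reflection is an isometry onto: `‖A_π(e₀ - x)‖ = ‖x - e₀‖`. [folklore] -/
theorem norm_reflect (x : EuclideanSpace ℝ (Fin m)) :
    ‖LinearIsometryEquiv.piLpCongrLeft 2 ℝ ℝ (Fin.revPerm.trans (finRotate m)).symm
        (EuclideanSpace.single (0 : Fin m) (1 : ℝ) - x)‖ =
      ‖x - EuclideanSpace.single (0 : Fin m) (1 : ℝ)‖ := by
  rw [LinearIsometryEquiv.norm_map, norm_sub_rev]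

end Model

/-! ### The reflected chart -/

section Reflection

variable {E : Type*} [NormedAddCommGroup E] [NormedSpace ℝ E] {H : Type*} [TopologicalSpace H]
  {I : ModelWithCorners ℝ E H} {M : Type*} [TopologicalSpace M] [ChartedSpace H M]
  {m : ℕ} [NeZero m] {Ψ' : OpenPartialHomeomorph M (EuclideanSpace ℝ (Fin m))}
  {ξ : Π x : M, TangentSpace I x} {k : ℕ} {v : ℝ → ℝ}

set_option backward.isDefEq.respectTransparency false in
/-- **The reflected chart.**  Let `Ψ'` be an `E`-valued chart, differentiable with
differentiable inverse, carrying `ξ` to `η⃗ = milnorCancellationField k v`, with target the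
ball `B(e₀, r)` inside both zones of the profile (`v(t) = 1 - t` for `|t - 1| < δ`, `v(t) = t`
for `|t| < δ`, `r ≤ δ`).  Then `Ψ'' = A_π ∘ (e₀ - ·) ∘ Ψ'` (`π` the reversal of the coordinates
`1, …, m - 1`) is a chart with the same domain, target `B(0, r)`, carrying `-ξ` to
`milnorCancellationField (m - 1 - k) v` — a chart of the lower type about `p' = Ψ'⁻¹(e₀)` for
the turned-about field (*"Replacing `f` by `-f` …"*).
[cite: MilnorHCobordism1965, Lemma 4.7, remark (PDF p. 25); Preliminary Hypothesis 5.5 (PDF p. 27)] -/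
theorem exists_reflectedChart (hΨ' : Ψ'.MDifferentiable I 𝓘(ℝ, EuclideanSpace ℝ (Fin m)))
    (hV' : ∀ q ∈ Ψ'.source, mfderiv I 𝓘(ℝ, EuclideanSpace ℝ (Fin m)) Ψ' q (ξ q) =
      milnorCancellationField k v (Ψ' q))
    (hk : k < m) {r δ : ℝ}
    (hr : Ψ'.target = Metric.ball (EuclideanSpace.single (0 : Fin m) (1 : ℝ)) r) (hrδ : r ≤ δ)
    (hvδ0 : ∀ t, |t| < δ → v t = t) (hvδ1 : ∀ t, |t - 1| < δ → v t = 1 - t) :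
    ∃ Ψ'' : OpenPartialHomeomorph M (EuclideanSpace ℝ (Fin m)),
      Ψ''.MDifferentiable I 𝓘(ℝ, EuclideanSpace ℝ (Fin m)) ∧ Ψ''.source = Ψ'.source ∧
      Ψ''.target = Metric.ball 0 r ∧
      (∀ q, Ψ'' q = LinearIsometryEquiv.piLpCongrLeft 2 ℝ ℝ (Fin.revPerm.trans (finRotate m)).symm
        (EuclideanSpace.single (0 : Fin m) (1 : ℝ) - Ψ' q)) ∧
      (∀ z, Ψ''.symm z = Ψ'.symm (EuclideanSpace.single (0 : Fin m) (1 : ℝ) -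
        (LinearIsometryEquiv.piLpCongrLeft 2 ℝ ℝ (Fin.revPerm.trans (finRotate m)).symm).symm z)) ∧
      ∀ q ∈ Ψ''.source, mfderiv I 𝓘(ℝ, EuclideanSpace ℝ (Fin m)) Ψ'' q ((-ξ) q) =
        milnorCancellationField (m - 1 - k) v (Ψ'' q) := by
  set e₀ : EuclideanSpace ℝ (Fin m) := EuclideanSpace.single (0 : Fin m) (1 : ℝ) with he₀
  set A := LinearIsometryEquiv.piLpCongrLeft 2 ℝ ℝ (Fin.revPerm.trans (finRotate m)).symm with hA
  set AL : EuclideanSpace ℝ (Fin m) →L[ℝ] EuclideanSpace ℝ (Fin m) :=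
    (A.toContinuousLinearEquiv : EuclideanSpace ℝ (Fin m) →L[ℝ] EuclideanSpace ℝ (Fin m)) with hAL
  have hALapply : ∀ x, AL x = A x := fun x => rfl
  -- the affine homeomorphism `T x = A (e₀ - x)`
  set T : EuclideanSpace ℝ (Fin m) ≃ₜ EuclideanSpace ℝ (Fin m) :=
    ((Homeomorph.neg (EuclideanSpace ℝ (Fin m))).trans (Homeomorph.addLeft e₀)).trans A.toHomeomorph
    with hT
  have hTapply : ∀ x, T x = A (e₀ - x) := fun x => by
    show A (e₀ + -x) = A (e₀ - x)
    rw [sub_eq_add_neg]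
  have hTfun : (T : EuclideanSpace ℝ (Fin m) → EuclideanSpace ℝ (Fin m)) = fun x => A e₀ - AL x := by
    funext x
    rw [hTapply, map_sub, hALapply]
  have hTsymm : ∀ z, T.symm z = e₀ - A.symm z := fun z =>
    T.injective (by rw [T.apply_symm_apply, hTapply, sub_sub_cancel, LinearIsometryEquiv.apply_symm_apply])
  have hTs : ContMDiff 𝓘(ℝ, EuclideanSpace ℝ (Fin m)) 𝓘(ℝ, EuclideanSpace ℝ (Fin m)) ∞ T := by
    rw [hTfun]
    exact contMDiff_iff_contDiff.2 (contDiff_const.sub AL.contDiff)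
  have hTs' : ContMDiff 𝓘(ℝ, EuclideanSpace ℝ (Fin m)) 𝓘(ℝ, EuclideanSpace ℝ (Fin m)) ∞ T.symm := by
    rw [show (T.symm : EuclideanSpace ℝ (Fin m) → EuclideanSpace ℝ (Fin m)) =
      fun z => e₀ - (A.symm.toContinuousLinearEquiv : EuclideanSpace ℝ (Fin m) →L[ℝ]
        EuclideanSpace ℝ (Fin m)) z from funext hTsymm]
    exact contMDiff_iff_contDiff.2 (contDiff_const.sub (ContinuousLinearMap.contDiff _))
  have hTmd : T.toOpenPartialHomeomorph.MDifferentiable 𝓘(ℝ, EuclideanSpace ℝ (Fin m))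
      𝓘(ℝ, EuclideanSpace ℝ (Fin m)) :=
    ⟨(hTs.mdifferentiable (by norm_cast)).mdifferentiableOn,
      (hTs'.mdifferentiable (by norm_cast)).mdifferentiableOn⟩
  -- the reflected chart
  set Ψ'' : OpenPartialHomeomorph M (EuclideanSpace ℝ (Fin m)) := Ψ'.transHomeomorph T with hΨ''
  have hΨ''apply : ∀ q, Ψ'' q = A (e₀ - Ψ' q) := fun q => hTapply (Ψ' q)
  have hΨ''fun : (⇑Ψ'' : M → EuclideanSpace ℝ (Fin m)) = T ∘ Ψ' := rfl
  have hΨ''symm : ∀ z, Ψ''.symm z = Ψ'.symm (e₀ - A.symm z) := fun z => by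
    show Ψ'.symm (T.symm z) = _
    rw [hTsymm]
  have hΨ''md : Ψ''.MDifferentiable I 𝓘(ℝ, EuclideanSpace ℝ (Fin m)) := by
    rw [hΨ'', OpenPartialHomeomorph.transHomeomorph_eq_trans]
    exact hΨ'.trans hTmd
  refine ⟨Ψ'', hΨ''md, rfl, ?_, hΨ''apply, hΨ''symm, fun q hq => ?_⟩
  · -- target
    show T.symm ⁻¹' Ψ'.target = Metric.ball 0 r
    ext z
    rw [mem_preimage, hr, hTsymm, Metric.mem_ball, Metric.mem_ball, dist_eq_norm, dist_zero_right,
      sub_sub_cancel_left, norm_neg, A.symm.norm_map]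
  · -- the differential on `-ξ`
    have hq' : q ∈ Ψ'.source := hq
    have h1 : HasMFDerivAt I 𝓘(ℝ, EuclideanSpace ℝ (Fin m)) Ψ' q
        (mfderiv I 𝓘(ℝ, EuclideanSpace ℝ (Fin m)) Ψ' q) :=
      (hΨ'.mdifferentiableAt hq').hasMFDerivAt
    have h2' : HasFDerivAt (T : EuclideanSpace ℝ (Fin m) → EuclideanSpace ℝ (Fin m)) (-AL) (Ψ' q) := by
      rw [hTfun]
      exact AL.hasFDerivAt.const_sub (A e₀)
    have h2 : HasMFDerivAt 𝓘(ℝ, EuclideanSpace ℝ (Fin m)) 𝓘(ℝ, EuclideanSpace ℝ (Fin m)) T (Ψ' q)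
        (-AL) := hasMFDerivAt_iff_hasFDerivAt.2 h2'
    have h3 := h2.comp q h1
    rw [hΨ''fun, h3.mfderiv]
    -- the zone at `x = Ψ' q`
    have hx : Ψ' q ∈ Metric.ball e₀ r := by rw [← hr]; exact Ψ'.map_source hq'
    have hx0 : |Ψ' q 0 - 1| < δ := by
      have h1 : |(Ψ' q - e₀) 0| ≤ ‖Ψ' q - e₀‖ := by
        have := PiLp.norm_apply_le (Ψ' q - e₀) 0
        rwa [Real.norm_eq_abs] at this
      have h2 : ‖Ψ' q - e₀‖ < r := by rwa [Metric.mem_ball, dist_eq_norm] at hx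
      have h3 : (Ψ' q - e₀) 0 = Ψ' q 0 - 1 := by simp [he₀]
      rw [← h3]
      linarith
    have hv1 : v (Ψ' q 0) = 1 - Ψ' q 0 := hvδ1 _ hx0
    have hv0 : v (1 - Ψ' q 0) = 1 - Ψ' q 0 := by
      apply hvδ0
      rw [abs_sub_comm] at hx0
      exact hx0
    show (-AL) (mfderiv I 𝓘(ℝ, EuclideanSpace ℝ (Fin m)) Ψ' q ((-ξ) q)) =
      milnorCancellationField (m - 1 - k) v ((T ∘ Ψ') q)
    have e1 : mfderiv I 𝓘(ℝ, EuclideanSpace ℝ (Fin m)) Ψ' q ((-ξ) q) =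
        -(milnorCancellationField k v (Ψ' q)) := by
      have h := (mfderiv I 𝓘(ℝ, EuclideanSpace ℝ (Fin m)) Ψ' q).map_neg (ξ q)
      exact h.trans (congrArg Neg.neg (hV' q hq'))
    have e2 : ∀ w : EuclideanSpace ℝ (Fin m), (-AL) (-w) = A w := fun w => by
      simp [hALapply]
    refine (congrArg (fun w => (-AL) w) e1).trans ?_
    rw [e2, comp_apply, hTapply]
    exact piLpCongrLeft_milnorCancellationField_eq_reflect hk v hv1 hv0

/-! ### The duals: trajectories into `p'`, the left-hand sphere of `p'` -/

/-- **A trajectory going to `p' = Ψ'⁻¹(e₀)` is eventually a radial ray of the stable plane of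
`e₀`** — the dual of
`Literature.Topology.FourManifolds.exists_forall_apply_eq_exp_smul_of_tendsto_atBot`, obtained
from it through the reflected chart and time reversal: if `γ` is an integral curve of the
`C¹` field `ξ` on `[0, ∞)` tending to `Ψ'⁻¹(e₀)` as `t → +∞`, there is `t₀ ≥ 0` such that
for all `t ≥ t₀`: `γ t` lies in the chart domain, `Ψ'(γ t)` has `x_{k+1} = ⋯ = 0`, and
`Ψ'(γ t) - e₀ = e^{-(t - t₀)} (Ψ'(γ t₀) - e₀)` (PDF p. 18: *"If `y⃗` is zero this trajectory
is a straight line segment tending to the origin"*, here at the upper critical point).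
[cite: MilnorHCobordism1965, proof of Thm. 3.12 (PDF p. 18); Def. 3.9 (PDF p. 16); proof of Thm. 5.4, Assertion 6, (a) (PDF p. 30)] -/
theorem exists_forall_apply_sub_single_eq_exp_smul_of_tendsto_atTop [IsManifold I 1 M] [T2Space M]
    (hΨ' : Ψ'.MDifferentiable I 𝓘(ℝ, EuclideanSpace ℝ (Fin m)))
    (hV' : ∀ q ∈ Ψ'.source, mfderiv I 𝓘(ℝ, EuclideanSpace ℝ (Fin m)) Ψ' q (ξ q) =
      milnorCancellationField k v (Ψ' q))
    (hξ : CMDiff 1 (fun x => (⟨x, ξ x⟩ : TangentBundle I M))) (hk : k < m) {r δ : ℝ} (hr0 : 0 < r)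
    (hr : Ψ'.target = Metric.ball (EuclideanSpace.single (0 : Fin m) (1 : ℝ)) r) (hrδ : r ≤ δ)
    (hvδ0 : ∀ t, |t| < δ → v t = t) (hvδ1 : ∀ t, |t - 1| < δ → v t = 1 - t)
    {γ : ℝ → M} (hγ : IsMIntegralCurveOn γ ξ (Ici 0))
    (hlim : Tendsto γ atTop (𝓝 (Ψ'.symm (EuclideanSpace.single (0 : Fin m) (1 : ℝ))))) :
    ∃ t₀ : ℝ, 0 ≤ t₀ ∧ (∀ t, t₀ ≤ t → γ t ∈ Ψ'.source) ∧
      (∀ t, t₀ ≤ t → ∀ i : Fin m, k < (i : ℕ) → Ψ' (γ t) i = 0) ∧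
      ∀ t, t₀ ≤ t → Ψ' (γ t) - EuclideanSpace.single (0 : Fin m) (1 : ℝ) =
        Real.exp (-(t - t₀)) • (Ψ' (γ t₀) - EuclideanSpace.single (0 : Fin m) (1 : ℝ)) := by
  set e₀ : EuclideanSpace ℝ (Fin m) := EuclideanSpace.single (0 : Fin m) (1 : ℝ) with he₀
  set A := LinearIsometryEquiv.piLpCongrLeft 2 ℝ ℝ (Fin.revPerm.trans (finRotate m)).symm with hA
  obtain ⟨Ψ'', hΨ'', hsrc, htgt, happly, hsymm, hV''⟩ :=
    exists_reflectedChart hΨ' hV' hk hr hrδ hvδ0 hvδ1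
  have hk' : m - 1 - k < m := by have := NeZero.ne m; omega
  -- the reversed curve is an integral curve of `-ξ` on `(-∞, 0]` tending to `p'`
  have hγ' : IsMIntegralCurveOn (γ ∘ Neg.neg) (-ξ) (Iic 0) := by
    rw [isMIntegralCurveOn_comp_neg_iff]
    convert hγ using 1
    ext t
    simp
  have hp' : Ψ''.symm 0 = Ψ'.symm e₀ := by rw [hsymm, map_zero, sub_zero]
  have hlim' : Tendsto (γ ∘ Neg.neg) atBot (𝓝 (Ψ''.symm 0)) := by
    rw [hp']
    exact hlim.comp tendsto_neg_atBot_atTop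
  obtain ⟨t₀, ht₀, hsrc', hplane, hray⟩ :=
    exists_forall_apply_eq_exp_smul_of_tendsto_atBot hΨ'' hV'' hξ.neg_section hk' hr0 htgt hrδ hvδ0
      hγ' hlim'
  refine ⟨-t₀, by linarith, fun t ht => ?_, fun t ht i hik => ?_, fun t ht => ?_⟩
  · have h := hsrc' (-t) (by linarith)
    rw [hsrc] at h
    simpa using h
  · have h := hplane (-t) (by linarith)
    simp only [comp_apply, neg_neg, happly] at h
    exact (forall_reflect_apply_eq_zero_iff hk (Ψ' (γ t))).1 h i hik
  · have h := hray (-t) (by linarith)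
    simp only [comp_apply, neg_neg, happly] at h
    -- apply `A⁻¹` and rearrange
    have h1 : e₀ - Ψ' (γ t) = Real.exp (-t - t₀) • (e₀ - Ψ' (γ (-t₀))) := by
      have := congrArg A.symm h
      rwa [LinearIsometryEquiv.symm_apply_apply, LinearIsometryEquiv.map_smul,
        LinearIsometryEquiv.symm_apply_apply] at this
    have h2 : Ψ' (γ t) - e₀ = -(e₀ - Ψ' (γ t)) := (neg_sub _ _).symm
    rw [h2, h1, ← smul_neg, neg_sub]
    congr 1
    ring_nf

/-- **The left-hand sphere of `p'` just below `p'` is the image of the model sphere of the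
stable plane of `e₀`** — the dual of
`Literature.Topology.FourManifolds.rightHandSphere_eq_symm_image_of_ball` through the reflected
chart and the turned-about pair `(a - f, -ξ)`
(`Literature.Topology.FourManifolds.rightHandSphere_const_sub_neg`).  For `Ψ'` carrying the
`C¹` field `ξ` to `η⃗` and `f` to `F = milnorCancellationMorse k v c₀` with
`F(e₀) = c₀ + 2∫₀¹ v = f(p')`, target `B(e₀, r)` in both zones, and `ξ(f) ≥ 0`: for
`0 < t < r/4`, the left-hand sphere of `p'` in the level `f(p') - t²` is
`Ψ'⁻¹{x ∈ B(e₀, r) | x_{k+1} = ⋯ = 0, F(x) = f(p') - t²}`.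
[cite: MilnorHCobordism1965, Def. 3.9 (PDF p. 16), proof of Thm. 3.12 (PDF p. 18); proof of Thm. 5.4, Assertion 6, (b) (PDF p. 30); Lemma 4.7, remark (PDF p. 25)] -/
theorem leftHandSphere_eq_symm_image_of_ball [IsManifold I 1 M] [T2Space M]
    (hΨ' : Ψ'.MDifferentiable I 𝓘(ℝ, EuclideanSpace ℝ (Fin m)))
    (hV' : ∀ q ∈ Ψ'.source, mfderiv I 𝓘(ℝ, EuclideanSpace ℝ (Fin m)) Ψ' q (ξ q) =
      milnorCancellationField k v (Ψ' q))
    (hξ : CMDiff 1 (fun x => (⟨x, ξ x⟩ : TangentBundle I M))) (hk : k < m) {r δ : ℝ} (hr0 : 0 < r)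
    (hr : Ψ'.target = Metric.ball (EuclideanSpace.single (0 : Fin m) (1 : ℝ)) r) (hrδ : r ≤ δ)
    (hvδ0 : ∀ t, |t| < δ → v t = t ∧ 2 * ∫ s in (0 : ℝ)..t, v s = t ^ 2)
    (hvδ1 : ∀ t, |t - 1| < δ → v t = 1 - t ∧
      2 * ∫ s in (0 : ℝ)..t, v s = 2 * (∫ s in (0 : ℝ)..1, v s) - (t - 1) ^ 2)
    {f : M → ℝ} (hf : MDifferentiable I 𝓘(ℝ, ℝ) f) (hfξ : ∀ w, 0 ≤ mlineDeriv I f w (ξ w))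
    {c₀ : ℝ} (hc₀ : c₀ + 2 * ∫ s in (0 : ℝ)..1, v s = f (Ψ'.symm (EuclideanSpace.single (0 : Fin m) (1 : ℝ))))
    (hF : ∀ q ∈ Ψ'.source, f q = milnorCancellationMorse k v c₀ (Ψ' q))
    {t : ℝ} (ht : 0 < t) (htr : t < r / 4) :
    leftHandSphere I f ξ (Ψ'.symm (EuclideanSpace.single (0 : Fin m) (1 : ℝ)))
        (f (Ψ'.symm (EuclideanSpace.single (0 : Fin m) (1 : ℝ))) - t ^ 2) =
      Ψ'.symm '' {x ∈ Metric.ball (EuclideanSpace.single (0 : Fin m) (1 : ℝ)) r |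
        (∀ i : Fin m, k < (i : ℕ) → x i = 0) ∧
          milnorCancellationMorse k v c₀ x =
            f (Ψ'.symm (EuclideanSpace.single (0 : Fin m) (1 : ℝ))) - t ^ 2} := by
  set e₀ : EuclideanSpace ℝ (Fin m) := EuclideanSpace.single (0 : Fin m) (1 : ℝ) with he₀
  set A := LinearIsometryEquiv.piLpCongrLeft 2 ℝ ℝ (Fin.revPerm.trans (finRotate m)).symm with hA
  set p' : M := Ψ'.symm e₀ with hp'def
  obtain ⟨Ψ'', hΨ'', hsrc, htgt, happly, hsymm, hV''⟩ :=
    exists_reflectedChart hΨ' hV' hk hr hrδ (fun t ht => (hvδ0 t ht).1) (fun t ht => (hvδ1 t ht).1)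
  have hk' : m - 1 - k < m := by have := NeZero.ne m; omega
  have hp' : Ψ''.symm 0 = p' := by rw [hsymm, map_zero, sub_zero]
  -- the zones at a point of the ball about `e₀`
  have hzone : ∀ x ∈ Metric.ball e₀ r,
      (2 * ∫ s in (0 : ℝ)..(x 0), v s = 2 * (∫ s in (0 : ℝ)..1, v s) - (x 0 - 1) ^ 2) ∧
        2 * ∫ s in (0 : ℝ)..(1 - x 0), v s = (1 - x 0) ^ 2 := by
    intro x hx
    have h1 : |(x - e₀) 0| ≤ ‖x - e₀‖ := by
      have := PiLp.norm_apply_le (x - e₀) 0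
      rwa [Real.norm_eq_abs] at this
    have h2 : ‖x - e₀‖ < r := by rwa [Metric.mem_ball, dist_eq_norm] at hx
    have h3 : (x - e₀) 0 = x 0 - 1 := by simp [he₀]
    rw [h3] at h1
    refine ⟨(hvδ1 _ (by linarith)).2, (hvδ0 _ ?_).2⟩
    rw [abs_sub_comm] at h1
    linarith
  -- the turned-about function `0 - f` in the reflected chart
  have hf'' : MDifferentiable I 𝓘(ℝ, ℝ) fun y => (0 : ℝ) - f y := mdifferentiable_const_sub hf 0
  have hfξ'' : ∀ w, 0 ≤ mlineDeriv I (fun y => (0 : ℝ) - f y) w ((-ξ) w) := fun w => by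
    rw [Pi.neg_apply, mlineDeriv_const_sub (hf w), mlineDeriv_neg, neg_neg]
    exact hfξ w
  have hF'' : ∀ q ∈ Ψ''.source, (0 : ℝ) - f q =
      milnorCancellationMorse (m - 1 - k) v ((0 : ℝ) - f (Ψ''.symm 0)) (Ψ'' q) := by
    intro q hq
    rw [hsrc] at hq
    have hx : Ψ' q ∈ Metric.ball e₀ r := by rw [← hr]; exact Ψ'.map_source hq
    rw [hp', ← hc₀, happly, milnorCancellationMorse_reflect hk v c₀ 0 (hzone _ hx).1 (hzone _ hx).2,
      hF q hq]
  -- the primal statement for `(0 - f, -ξ)` in the reflected chart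
  have hP := rightHandSphere_eq_symm_image_of_ball hΨ'' hV'' hξ.neg_section hk' hr0 htgt hrδ hvδ0
    hf'' hfξ'' hF'' ht htr
  rw [hp'] at hP
  have hlevel : (0 : ℝ) - f p' + t ^ 2 = 0 - (f p' - t ^ 2) := by ring
  rw [hlevel, rightHandSphere_const_sub_neg] at hP
  rw [hP]
  -- identify the two images
  have hc₀' : (0 : ℝ) - f p' = 0 - (c₀ + 2 * ∫ s in (0 : ℝ)..1, v s) := by rw [hc₀]
  apply Subset.antisymm
  · rintro _ ⟨z, ⟨hz, hzplane, hFz⟩, rfl⟩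
    set x : EuclideanSpace ℝ (Fin m) := e₀ - A.symm z with hxdef
    have hzx : z = A (e₀ - x) := by
      rw [hxdef, sub_sub_cancel, LinearIsometryEquiv.apply_symm_apply]
    have hx : x ∈ Metric.ball e₀ r := by
      rw [Metric.mem_ball, dist_eq_norm, hxdef, sub_sub_cancel_left, norm_neg, A.symm.norm_map]
      simpa using hz
    refine ⟨x, ⟨hx, ?_, ?_⟩, (hsymm z).symm ▸ rfl⟩
    · rw [hzx] at hzplane
      exact (forall_reflect_apply_eq_zero_iff hk x).1 hzplane
    · rw [hzx, hc₀', milnorCancellationMorse_reflect hk v c₀ 0 (hzone _ hx).1 (hzone _ hx).2] at hFz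
      linarith
  · rintro _ ⟨x, ⟨hx, hxplane, hFx⟩, rfl⟩
    set z : EuclideanSpace ℝ (Fin m) := A (e₀ - x) with hzdef
    have hz : z ∈ Metric.ball (0 : EuclideanSpace ℝ (Fin m)) r := by
      rw [Metric.mem_ball, dist_zero_right, hzdef, norm_reflect]
      rwa [Metric.mem_ball, dist_eq_norm] at hx
    refine ⟨z, ⟨hz, ?_, ?_⟩, ?_⟩
    · exact (forall_reflect_apply_eq_zero_iff hk x).2 hxplane
    · rw [hzdef, hc₀', milnorCancellationMorse_reflect hk v c₀ 0 (hzone _ hx).1 (hzone _ hx).2, hFx]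
    · rw [hsymm, hzdef, LinearIsometryEquiv.symm_apply_apply, sub_sub_cancel]

end Reflection

end Literature.Topology.FourManifolds
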